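import Literature.AnabelianGeometry.EtaleTheta.Discharge.Sec5OriginClausesOfPushforward

/-!
# [EtTh] §3/§5 origin clauses, WEAKEST SHAPE: `D → D₀ → D^cnst` need only FACTOR THROUGH the [FrdII] Ex. 1.3 (ii) push-forward `aug_*`
# on arrows (pp. 298, 322, 331 / PDF pp. 72, 96, 105)

Mochizuki, *The étale theta function and its Frobenioid-theoretic manifestations*, Publ. RIMS **45** (2009)
[cite: MochizukiEtTh2009, §3 p.298 (PDF p.72); §5 p.322 (PDF p.96); Lem 5.8 p.331 (PDF p.105)]; Mochizuki, *The geometry of Frobenioids II*,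
Kyushu J. Math. **62** (2008), Ex. 1.3 (ii) p.11 [cite: MochizukiFrdII2008, Ex 1.3 (ii) p.11].  abc-iut cell, layer L2 by signature (seat
abc-iut-w4-d008, gen 4).  PROOF-ONLY v2 companion (0 definitions) of this seat's `Discharge/Sec5OriginClausesOfPushforward.lean` (p433787).

WHY.  p433787 states the origin clauses for an identification `e : tf.base ⋙ cnst ≅ aug_* ⋙ G` of functors.  Print's `D^cnst := B(Spec K)⁰ =
B(G_K)⁰` (§3 p.298) is the category of FINITE connected `G_K`-sets, a full subcategory `ι : D^cnst ↪ B^temp(G_K)⁰`, and "the natural functor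
`D₀ → D^cnst` determined by `Π^tp_X ↠ G_K` [cf. [FrdII], Example 1.3, (ii)]" says `(D → D₀ → D^cnst) ⋙ ι ≅ aug_*` — an identification on the
OTHER side.  The only thing the origin clauses use is the consequence common to both shapes:

  `hfactor : ∀ f f', aug_*(f) = aug_*(f') → cnst(base f) = cnst(base f')` — «`D → D₀ → D^cnst` factors through `aug_*` on arrows».

This file (A) derives `hfactor` from the iso shape (`factorsOnArrows_of_iso_comp`) and from the print shape with `ι` faithful
(`factorsOnArrows_of_comp_iso_faithful`), and (B) proves the conclusions at the genuine §5 data over `B^temp(Π^tp_X)⁰` for ANY functor `F` on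
`B^temp(Π^tp_X)⁰` factoring through `aug_*` on arrows (`F := tf.base ⋙ cnst` recovers the `cnst`-forms by `Functor.comp_map`):
`map_rho_eq_of_aug_eq_of_factors`, `map_rho_eq_id_of_aug_eq_one_of_factors` (`hΔcnst` shape), `exists_mem_HB_map_eq_of_factors` (`hcnst`
shape; T56-L09b `hconst` then by `TemperedFrobenioid.ratFnFunctor_map_unit_eq_of_cnst`) — so the v-next census line for the `cnst` input of the
§5 discharge files reads: «`cnst ∘ base` factors through `aug_*` on arrows» (+ abc-iut-L2-t3's `Prop34Cnst`).
HONEST FRAMING: kernel-checked category theory over the typed interfaces; `tf`, `cnst` stay abstract; nothing of [EtTh] §5 is asserted; typed ≠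
proved; no side taken on [IUTchIII] Cor. 3.12.
-/

noncomputable section

namespace Literature.AnabelianGeometry.EtaleTheta

open CategoryTheory Opposite Literature.AlgebraicGeometry.Frobenioids Literature.AlgebraicGeometry.Frobenioids.QuasiTemperoid
  Literature.AnabelianGeometry.SemiGraphs Literature.AnabelianGeometry.SemiGraphs.GaloisObjects

universe u₀ v₀ u₁ v₁ u₂ v₂ u₃ v₃ u₄ v₄ u v w

/-! ### (A) «factors through `P` on arrows» from the two identification shapes -/

namespace CnstPushforward

/-- From an identification `F ≅ P ⋙ G`: `F` factors through `P` on arrows. [folklore] -/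
private theorem map_eq_of_iso_comp' {C : Type u₁} [Category.{v₁} C] {D' : Type u₂} [Category.{v₂} D'] {E : Type u₃}
    [Category.{v₃} E] {F : C ⥤ E} {P : C ⥤ D'} {G : D' ⥤ E} (e : F ≅ P ⋙ G) {A B : C} {f f' : A ⟶ B}
    (h : P.map f = P.map f') : F.map f = F.map f' := by
  rw [← cancel_mono (e.hom.app B), e.hom.naturality, e.hom.naturality, Functor.comp_map, Functor.comp_map, h]

/-- **The iso shape ⇒ factoring on arrows**: if `F ≅ P ⋙ G` then `P(f) = P(f')` implies `F(f) = F(f')` (the iso reading of "the natural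
functor `D₀ → D^cnst` determined by `Π^tp_X ↠ G_K`", [EtTh] §3 p.298, used by p433787).  [cite: MochizukiEtTh2009, §3 p.298 (PDF p.72)] -/
theorem factorsOnArrows_of_iso_comp {C : Type u₁} [Category.{v₁} C] {D' : Type u₂} [Category.{v₂} D'] {E : Type u₃}
    [Category.{v₃} E] {F : C ⥤ E} {P : C ⥤ D'} {G : D' ⥤ E} (e : F ≅ P ⋙ G) :
    ∀ ⦃A B : C⦄ (f f' : A ⟶ B), P.map f = P.map f' → F.map f = F.map f' :=
  fun _ _ _ _ h => map_eq_of_iso_comp' e h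

/-- **The print shape ⇒ factoring on arrows**: if `F ⋙ ι ≅ P ⋙ G` with `ι` FAITHFUL (print: `ι` the inclusion `D^cnst = B(G_K)⁰ ↪ B^temp(G_K)⁰`
of [EtTh] §3 p.298, `G = 𝟭`), then `P(f) = P(f')` implies `F(f) = F(f')`.  [cite: MochizukiEtTh2009, §3 p.298 (PDF p.72)] -/
theorem factorsOnArrows_of_comp_iso_faithful {C : Type u₁} [Category.{v₁} C] {D' : Type u₂} [Category.{v₂} D'] {E : Type u₃}
    [Category.{v₃} E] {E' : Type u₄} [Category.{v₄} E'] {F : C ⥤ E} (ι : E ⥤ E') [ι.Faithful] {P : C ⥤ D'} {G : D' ⥤ E'}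
    (e : F ⋙ ι ≅ P ⋙ G) :
    ∀ ⦃A B : C⦄ (f f' : A ⟶ B), P.map f = P.map f' → F.map f = F.map f' :=
  fun _ _ f f' h => ι.map_injective (by
    have h' := map_eq_of_iso_comp' e (f := f) (f' := f') h
    rwa [Functor.comp_map, Functor.comp_map] at h')

/-- Functors respect conjugation of automorphisms along an isomorphism (restated from p433787, where it is private). [folklore] -/
private theorem map_conjAut_hom_eq' {C : Type u₂} [Category.{v₂} C] {E : Type u₃} [Category.{v₃} E] (F : C ⥤ E) {A B : C}
    (β : A ≅ B) {e e' : Aut A} (h : F.map e.hom = F.map e'.hom) :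
    F.map (β.conjAut e).hom = F.map (β.conjAut e').hom := by
  rw [Iso.conjAut_hom, Iso.conjAut_hom, Iso.conj_apply, Iso.conj_apply, F.map_comp, F.map_comp, F.map_comp,
    F.map_comp, h]

end CnstPushforward

/-! ### (B) At the genuine §5 data: ANY functor on `B^temp(Π^tp_X)⁰` factoring through `aug_*` on arrows identifies `ρ_N(y)`, `ρ_N(y')`
whenever `aug(ιX y) = aug(ιX y')` -/

namespace ThetaFrobenioid

open CnstPushforward

variable {K : Type u₀} [Field K] {X : SemiGraphs.TemperedArithmeticGroup.{u₀} K} {D₀ : Type u₀} [Category.{v₀} D₀]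
  {V : FrdIMonoidStub.{w}} {T₀ : RealifiedDivisorMonoids (D₀ := D₀) V}
  {VD : FrdICatStub.{u₀ + 1, u₀, w} (ConnectedPart (BTemp X.Pi))}
  {tf : TemperedFrobenioid T₀ (ConnectedPart (BTemp X.Pi)) VD} {hZ : tf.monoidType = MonoidType.Z}
  {hP : ∀ A : (ConnectedPart (BTemp X.Pi))ᵒᵖ, IsPerfect (tf.Φ.carrier A)}
  {NH : Subgroup (Field.absoluteGaloisGroup K) → tf.category → ℕ+ → Prop} {A₀ : tf.category}
  {hA₀ : PreFrobenioid.IsFrobeniusTrivial tf.toElem A₀} {hA₀' : SemiGraphs.IsGaloisObj A₀.base.obj}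
  {pullFrac : ∀ {A A' : (BiKummerSetting.mkOfConnectedTemperoid X tf hZ hP NH A₀ hA₀ hA₀').C} (_ : A' ⟶ A),
    (BiKummerSetting.mkOfConnectedTemperoid X tf hZ hP NH A₀ hA₀ hA₀').biratUnits A →
      (BiKummerSetting.mkOfConnectedTemperoid X tf hZ hP NH A₀ hA₀ hA₀').biratUnits A'}
  {lv N : ℕ+} {T : ThetaEnvData.{max u₀ w} N}
  {θ : (BiKummerSetting.mkOfConnectedTemperoid X tf hZ hP NH A₀ hA₀ hA₀').biratUnits
    (BiKummerSetting.mkOfConnectedTemperoid X tf hZ hP NH A₀ hA₀ hA₀').Aodot}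
  {Bl : (BiKummerSetting.mkOfConnectedTemperoid X tf hZ hP NH A₀ hA₀ hA₀').C}
  {Pl : (BiKummerSetting.mkOfConnectedTemperoid X tf hZ hP NH A₀ hA₀ hA₀').FractionPair θ Bl}
  {Rl : (BiKummerSetting.mkOfConnectedTemperoid X tf hZ hP NH A₀ hA₀ hA₀').NthRoot θ Pl lv pullFrac}
  (h : ModelFrobenioid.Hypotheses tf.divisorMonoid tf.ratFnFunctor)
  (Q : FrobenioidTheta.ThetaSubquotientStub.{w} (ConnectedPart (BTemp X.Pi))) (odd_l : Odd (lv : ℕ))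
  (R : (BiKummerSetting.mkOfConnectedTemperoid X tf hZ hP NH A₀ hA₀ hA₀').NthRoot Rl.root Rl.pair N pullFrac)
  (ιX : T.PiX ≃ₜ* X.Pi) (K' : Type w) [Field K'] (constEmb : K'ˣ →* tf.biratUnitsModel R.BN)
  (constEmb_injective : Function.Injective constEmb)
  (hinvc : ∀ g : Aut R.AN.base,
    pull tf.divisorMonoid g.hom (ModelFrobenioid.div R.pair.num) = ModelFrobenioid.div R.pair.num)
  (hinvp : ∀ y : T.PiX, y ∈ T.PiYdd →
    pull tf.divisorMonoid ((BiKummerSetting.mkOfConnectedTemperoid X tf hZ hP NH A₀ hA₀ hA₀').galoisSurj R.AN.base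
      R.αData.isGalois (ιX y)).hom (ModelFrobenioid.div R.pair.den) = ModelFrobenioid.div R.pair.den)
  (haug : IsOpenMap X.aug) {E : Type u₁} [Category.{v₁} E] (F : ConnectedPart (BTemp X.Pi) ⥤ E)
  (hF : ∀ ⦃A B : ConnectedPart (BTemp X.Pi)⦄ (f f' : A ⟶ B),
    (QuasiTemperoid.pushforward X.aug.toMonoidHom X.aug_surjective haug).map f =
      (QuasiTemperoid.pushforward X.aug.toMonoidHom X.aug_surjective haug).map f' → F.map f = F.map f')

include hF in
/-- **Any functor `F` on `B^temp(Π^tp_X)⁰` that factors through `aug_*` on arrows only sees the augmentation of `ρ_N`**: for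
`aug(ιX y) = aug(ιX y')`, `F(ρ_N y) = F(ρ_N y')` (take `F := tf.base ⋙ cnst` for the constant-field composite of [EtTh] §3 p.298, in either
identification shape of part (A)).  [cite: MochizukiEtTh2009, §3 p.298 (PDF p.72); §5 p.331 (PDF p.105)] -/
theorem map_rho_eq_of_aug_eq_of_factors {y y' : T.PiX} (hyy' : X.aug (ιX y) = X.aug (ιX y')) :
    F.map (rhoOfBiKummerData R ιX y).hom = F.map (rhoOfBiKummerData R ιX y').hom := by
  refine hF _ _ ?_
  rw [rhoOfBiKummerData_apply, rhoOfBiKummerData_apply]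
  refine map_conjAut_hom_eq' _ _ ?_
  rw [galoisSurj_hom_eq_homMk, galoisSurj_hom_eq_homMk]
  exact pushforward_map_galoisSurjOf_eq X.aug.toMonoidHom X.aug_surjective haug X.isTempered R.AN.base R.αData.isGalois hyy'

include hF in
/-- … and kills geometric `δ` (`aug(ιX δ) = 1`): `F(ρ_N δ) = id` — the `hΔcnst` shape for any such `F`.
[cite: MochizukiEtTh2009, §3 p.298 (PDF p.72)] -/
theorem map_rho_eq_id_of_aug_eq_one_of_factors {δ : T.PiX} (hδ : X.aug (ιX δ) = 1) :
    F.map (rhoOfBiKummerData R ιX δ).hom = 𝟙 (F.obj R.BN.base) := by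
  have h1 : X.aug (ιX δ) = X.aug (ιX 1) := by rw [hδ, map_one, map_one]
  rw [map_rho_eq_of_aug_eq_of_factors R ιX haug F hF h1, map_one]
  exact F.map_id _

include hF in
/-- … and, given `hYdd`, sees every `y ∈ Im(Π^tp_Y̲)` as some `h ∈ H_{B_N} = Im(Π^tp_Ÿ̲)` — the `hcnst` shape for any such `F` (with
`F := tf.base ⋙ cnst` this is the binder `hcnst` of `hfac_ofConnectedTemperoidData_of_cnst`, by `Functor.comp_map`).
[cite: MochizukiEtTh2009, §5 p.322 (PDF p.96); Lem 5.8 p.331 (PDF p.105)] -/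
theorem exists_mem_HB_map_eq_of_factors (hYdd : ∀ y : T.PiX, ∃ k ∈ T.PiYdd, X.aug (ιX k) = X.aug (ιX y)) :
    ∀ y ∈ (ofConnectedTemperoidData h Q odd_l R ιX K' constEmb constEmb_injective hinvc hinvp).imPiY,
      ∃ k ∈ (ofConnectedTemperoidData h Q odd_l R ιX K' constEmb constEmb_injective hinvc hinvp).HB,
        F.map y.hom = F.map k.hom := by
  intro y hy
  obtain ⟨y₀, -, rfl⟩ := Subgroup.mem_map.mp hy
  obtain ⟨k₀, hk₀, hk⟩ := hYdd y₀
  exact ⟨rhoOfBiKummerData R ιX k₀, Subgroup.mem_map_of_mem _ hk₀, map_rho_eq_of_aug_eq_of_factors R ιX haug F hF hk.symm⟩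

end ThetaFrobenioid

end Literature.AnabelianGeometry.EtaleTheta

end
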